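import Summits.CriticalPhenomena.SAWScalingLimit.Theses.SAWChargeContinuation
import Summits.CriticalPhenomena.SAWScalingLimit.Theorems.SAWPoissonBanksMutualAvoidanceLawOfScalingLimit
import Summits.CriticalPhenomena.SAWScalingLimit.Theorems.SAWChargeContinuationSAWAvoidanceLawPassage
import Summits.CriticalPhenomena.SAWScalingLimit.Theorems.SAWLoopFugacityFlowSimpleSubseqLimitsStubRangeIsArcBoundary

/-!
# `SAWAvoidanceLaw` (route `SAWChargeContinuation`) is a corollary of the sub-problem `SAWScalingLimit`

Support file for item `stmt-CriticalPhenomena-11195`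
(`Summit.CriticalPhenomena.SAWScalingLimit.Theses.SAWChargeContinuation.SAWAvoidanceLaw`: for every
Dobrushin domain `(D; a, b)`, hull subdomain `D'`, endpoint approximation, chordal uniformizer `φ`
and restriction data `(Φ, d = Φ'_A(0))` of `A = closure (ℍ ∖ φ⁻¹ D')`, the probability that the
critical `δℤ²` SAW from `a_δ` to `b_δ` in `D_δ` uses only mesh vertices of `D'` and closed mesh
edges of `cl D'` — the LATTICE avoidance event `E_δ(D')` — tends to `d^{5/8}` as `δ → 0⁺`).

* `sawAvoidanceLaw_of_sawScalingLimit : SAWScalingLimit → SAWAvoidanceLaw` — the item is implied by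
  the sub-problem statement (Lawler–Schramm–Werner's conjecture as typed in the tree), with NO other
  hypothesis: every SLE-side input is a theorem of the tree. Hence the item cannot be refuted without
  refuting the conjunct `SAWScalingLimit` itself, and targeting it loses nothing.
* `avoidanceLimit_of_sawScalingLimit : SAWScalingLimit → AvoidanceLimit` — composed with the passage
  `avoidanceLimit_of_sawAvoidanceLaw` (sibling file), the closed-range crux of route
  `SAWLoopFugacityFlow` (stmt-CriticalPhenomena-10649) is likewise a corollary of the sub-problem.

## Proof

Fix the data and let `μ` be the law of the SLE_{8/3} curve `Γ` given by `SAWScalingLimit` for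
`(D; a_δ, b_δ)`; the pushed-forward SAW laws `ν_δ` converge weakly to `μ` along `δ → 0⁺`.
Portmanteau SANDWICH (`tendsto_of_sandwich`, a three-term form of the two-term lemma of
`SAWPoissonBanksMutualAvoidanceLawOfScalingLimit`): with the closed event `E = {range ⊆ cl D'}` and
the open event `O = {range misses cl (D ∖ D')}` one has, on the lattice and for distinct endpoints,
`{curve ∈ O} ⊆ E_δ(D') ⊆ {curve ∈ E}` (`darts_of_curve_mem_rangeSubset_compl_closure_diff`: a vertex
on the trace lies in `D` off `D ∖ D'`, i.e. in `D'`, and a closed edge on the trace lies in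
`cl D ∖ cl (D ∖ D') ⊆ cl D'`; `curve_mem_rangeSubset_of_darts` of the passage file), while under `μ`
the difference `E ∖ O` ("the trace stays in `cl D'` but touches `∂D'` off `{a, b}`") is null
(`sle_measure_diff_avoid_eq_zero`: [LSW] Thm. 6.1 transposed + Rohde–Schramm simplicity). Hence
`P_δ(E_δ(D')) → μ(E) = Φ'_A(0)^{5/8}` (`SLEAvoidanceValue_proof`, [LSW] Thm. 6.1, value form), and
`d = Φ'_A(0) > 0` ([LSW] (2.4)) lets one pass to `toReal`.

## References

* G. F. Lawler, O. Schramm, W. Werner, *Conformal restriction: the chordal case*, J. Amer. Math.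
  Soc. 16 (2003), Thm. 6.1 (p. 23), (2.4) (p. 7).
* G. F. Lawler, O. Schramm, W. Werner, *On the scaling limit of planar self-avoiding walk*, Proc.
  Sympos. Pure Math. 72 (2004), §3.4 and Prediction 5.
* P. Billingsley, *Convergence of Probability Measures*, 2nd ed. (1999), Thm. 2.1 (portmanteau).
-/

noncomputable section

open MeasureTheory Filter Topology Set Metric
open scoped NNReal ENNReal BoundedContinuousFunction
open Literature.Probability Literature.Probability.LatticeModels
open Literature.Probability.RandomPlanarGeometry
open UpperHalfPlane (upperHalfPlaneSet)
open Summit.CriticalPhenomena.SAWScalingLimit.Theses.SAWChargeContinuation (SAWAvoidanceLaw)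
open Summit.CriticalPhenomena.SAWScalingLimit.Theses.SAWLoopFugacityFlow (AvoidanceLimit)

namespace Summit.CriticalPhenomena.SAWScalingLimit.Theorems.SAWChargeContinuation

/-! ### A three-term portmanteau sandwich along `𝓝[>] 0` -/

-- adapted from Summits/CriticalPhenomena/SAWScalingLimit/Theorems/SAWPoissonBanksMutualAvoidanceLawOfScalingLimit.lean
/-- **Closed/open sandwich (portmanteau), three-term form.** Let `ν_δ`, eventually probability
measures on `CurveClass ℂ`, converge weakly to the probability measure `μ` along `δ → 0⁺`. If `E` is
closed, `O` is open, `μ(E ∖ O) = 0`, and `p_δ` is eventually squeezed as `ν_δ(O) ≤ p_δ ≤ ν_δ(E)`, then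
`p_δ → μ(E)`: `limsup p_δ ≤ limsup ν_δ(E) ≤ μ(E)` (closed half of the portmanteau theorem) and
`μ(E) = μ(E ∩ O) ≤ μ(O) ≤ liminf ν_δ(O) ≤ liminf p_δ` (open half).
[cite: BillingsleyCPM1999, Thm. 2.1] -/
theorem tendsto_of_sandwich {ν : ℝ → Measure (CurveClass ℂ)} {μ : Measure (CurveClass ℂ)}
    [IsProbabilityMeasure μ]
    (hprob : ∀ᶠ δ in 𝓝[>] (0 : ℝ), IsProbabilityMeasure (ν δ))
    (hlim : ∀ f : CurveClass ℂ →ᵇ ℝ,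
      Tendsto (fun δ ↦ ∫ x, f x ∂ν δ) (𝓝[>] (0 : ℝ)) (𝓝 (∫ x, f x ∂μ)))
    {E O : Set (CurveClass ℂ)} (hE : IsClosed E) (hO : IsOpen O) (hnull : μ (E \ O) = 0)
    (p : ℝ → ℝ≥0∞) (hOp : ∀ᶠ δ in 𝓝[>] (0 : ℝ), ν δ O ≤ p δ)
    (hpE : ∀ᶠ δ in 𝓝[>] (0 : ℝ), p δ ≤ ν δ E) :
    Tendsto p (𝓝[>] (0 : ℝ)) (𝓝 (μ E)) := by
  classical
  let μP : ProbabilityMeasure (CurveClass ℂ) := ⟨μ, inferInstance⟩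
  let P : ℝ → ProbabilityMeasure (CurveClass ℂ) := fun δ ↦
    if h : IsProbabilityMeasure (ν δ) then ⟨ν δ, h⟩ else μP
  have hPeq : ∀ᶠ δ in 𝓝[>] (0 : ℝ), ((P δ : ProbabilityMeasure (CurveClass ℂ)) :
      Measure (CurveClass ℂ)) = ν δ := by
    filter_upwards [hprob] with δ hδ
    simp only [P, dif_pos hδ, ProbabilityMeasure.coe_mk]
  have hPlim : Tendsto P (𝓝[>] (0 : ℝ)) (𝓝 μP) := by
    rw [ProbabilityMeasure.tendsto_iff_forall_integral_tendsto]
    intro f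
    refine (hlim f).congr' ?_
    filter_upwards [hPeq] with δ hδ
    rw [hδ]
  have hsup : limsup p (𝓝[>] (0 : ℝ)) ≤ μ E := by
    have h := ProbabilityMeasure.limsup_measure_closed_le_of_tendsto hPlim hE
    have hc : limsup (fun δ ↦ ((P δ : ProbabilityMeasure (CurveClass ℂ)) :
        Measure (CurveClass ℂ)) E) (𝓝[>] (0 : ℝ)) = limsup (fun δ ↦ ν δ E) (𝓝[>] (0 : ℝ)) :=
      limsup_congr (hPeq.mono fun δ hδ ↦ by rw [hδ])
    rw [hc] at h
    exact (limsup_le_limsup hpE).trans h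
  have hinf : μ E ≤ liminf p (𝓝[>] (0 : ℝ)) := by
    have h := ProbabilityMeasure.le_liminf_measure_open_of_tendsto hPlim hO
    have h2 : liminf (fun δ ↦ ((P δ : ProbabilityMeasure (CurveClass ℂ)) :
          Measure (CurveClass ℂ)) O) (𝓝[>] (0 : ℝ)) ≤ liminf p (𝓝[>] (0 : ℝ)) := by
      refine liminf_le_liminf ?_
      filter_upwards [hPeq, hOp] with δ hδ hle
      rw [hδ]
      exact hle
    have h3 : μ E ≤ μ O := by
      have hsplit : μ (E ∩ O) + μ (E \ O) = μ E := measure_inter_add_sdiff E hO.measurableSet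
      calc μ E = μ (E ∩ O) + μ (E \ O) := hsplit.symm
        _ = μ (E ∩ O) := by rw [hnull, add_zero]
        _ ≤ μ O := measure_mono inter_subset_right
    exact h3.trans (h.trans h2)
  exact tendsto_of_le_liminf_of_limsup_le hinf hsup

/-! ### The lattice side: `{range misses cl (Ω ∖ Ω')} ⊆ E_δ(Ω')` -/

variable {Ω : Set ℂ} {δ : ℝ} {u v : Site 2}

/-- **Inner half of the lattice sandwich.** If the polyline of a SAW of `Ω_δ` misses
`cl (Ω ∖ Ω')`, `Ω' ⊆ Ω`, then every dart of the walk is a closed mesh edge of `cl Ω'` between mesh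
vertices of `Ω'`: the vertices lie on the trace and in `Ω`, hence in `Ω ∖ cl (Ω ∖ Ω') ⊆ Ω'`, and the
closed edges lie on the trace and in `cl Ω = cl Ω' ∪ cl (Ω ∖ Ω')`, hence in `cl Ω'`. [folklore] -/
theorem darts_of_curve_mem_rangeSubset_compl_closure_diff {Ω' : Set ℂ} (hsub : Ω' ⊆ Ω)
    (γ : SAW.DomainSAW Ω δ u v)
    (h : γ.curve ∈ CurveClass.rangeSubset (closure (Ω \ Ω'))ᶜ) :
    ∀ e ∈ γ.walk.darts, (meshGraph Ω' δ).Adj e.fst e.snd ∧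
      e.fst ∈ meshVertices Ω' δ ∧ e.snd ∈ meshVertices Ω' δ := by
  rw [CurveClass.mem_rangeSubset, AvoidanceLimit.Negative.range_curve] at h
  have hsplit : closure Ω ⊆ closure Ω' ∪ closure (Ω \ Ω') := by
    rw [← closure_union, Set.union_sdiff_cancel hsub]
  have hvert : ∀ w ∈ γ.walk.support, w ∈ meshDomain Ω δ → w ∈ meshVertices Ω' δ := by
    intro w hw hwD
    have hwΩ : meshPoint δ w ∈ Ω := meshDomain_subset_meshVertices Ω δ hwD
    have hw' : meshPoint δ w ∉ closure (Ω \ Ω') := h (SimpleGraph.Walk.mem_range_toCurve _ _ hw)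
    by_contra hwΩ'
    exact hw' (subset_closure ⟨hwΩ, hwΩ'⟩)
  intro e he
  obtain ⟨hmesh, hfst, hsnd⟩ := discreteDomainGraph_adj_iff.1 e.adj
  obtain ⟨hzd, hseg⟩ := meshGraph_adj_iff.1 hmesh
  refine ⟨meshGraph_adj_iff.2 ⟨hzd, fun z hz ↦ ?_⟩,
    hvert _ (γ.walk.dart_fst_mem_support_of_mem_darts he) hfst,
    hvert _ (γ.walk.dart_snd_mem_support_of_mem_darts he) hsnd⟩
  have hz' : z ∉ closure (Ω \ Ω') := h (segment_subset_range_toCurve (meshPoint δ) γ.walk e he hz)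
  rcases hsplit (hseg hz) with h1 | h1
  · exact h1
  · exact absurd h1 hz'

/-- The pushed-forward SAW law of a set of curve classes is at most the SAW law of any event
containing all walks whose curve lies in it. [folklore] -/
theorem map_law_le_law {O : Set (CurveClass ℂ)} (hO : MeasurableSet O)
    {S : Set (SAW.DomainSAW Ω δ u v)} (h : ∀ γ : SAW.DomainSAW Ω δ u v, γ.curve ∈ O → γ ∈ S) :
    (SAW.law Ω δ u v).map (fun γ ↦ γ.curve) O ≤ SAW.law Ω δ u v S := by
  rw [Measure.map_apply (SAW.DomainSAW.measurable_of_top _) hO]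
  exact measure_mono fun γ hγ ↦ h γ hγ

/-- The SAW law of an event is at most the pushed-forward law of any set of curve classes
containing the curves of all its walks. [folklore] -/
theorem law_le_map_law {E : Set (CurveClass ℂ)} (hE : MeasurableSet E)
    {S : Set (SAW.DomainSAW Ω δ u v)} (h : ∀ γ ∈ S, γ.curve ∈ E) :
    SAW.law Ω δ u v S ≤ (SAW.law Ω δ u v).map (fun γ ↦ γ.curve) E := by
  rw [Measure.map_apply (SAW.DomainSAW.measurable_of_top _) hE]
  exact measure_mono fun γ hγ ↦ h γ hγ

/-! ### The theorem -/

/-- **`SAWScalingLimit → SAWAvoidanceLaw`.** If the critical planar SAW converges in law to chordal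
SLE_{8/3} (the sub-problem statement), then for every Dobrushin domain `(D; a, b)`, hull subdomain
`D'`, endpoint approximation, chordal uniformizer `φ` and restriction data `(Φ, d)` of the pulled-back
hull `A = closure (ℍ ∖ φ⁻¹ D')`, the probability of the lattice avoidance event
`E_δ(D') = {all darts are closed mesh edges of cl D' between mesh vertices of D'}` tends to `d^{5/8}`.
Proof: portmanteau sandwich `{range misses cl (D ∖ D')} ⊆ E_δ(D') ⊆ {range ⊆ cl D'}` (open ⊆ · ⊆
closed, equal under the SLE_{8/3} law up to the null touching event, [LSW] Thm. 6.1 + Rohde–Schramm),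
and the value `μ_SLE{range ⊆ cl D'} = Φ'_A(0)^{5/8}` ([LSW] Thm. 6.1, `SLEAvoidanceValue_proof`).
The inlined lets `hull` / `pb` of the route decl are `MarkedDomain.IsHullSubdomain` /
`ConformalEquiv.pullbackHull` definitionally. [cite: LawlerSchrammWerner2003Restriction, Thm. 6.1 (p. 23)] -/
theorem sawAvoidanceLaw_of_sawScalingLimit (hS : _root_.SAWScalingLimit) : SAWAvoidanceLaw := by
  intro D D' hD' a b hab φ hφ Φ d hΦ hd
  -- fold the inlined lets of the route decl
  have hHull : D.IsHullSubdomain D' := hD'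
  change ConformalEquiv (upperHalfPlaneSet \ φ.pullbackHull D') upperHalfPlaneSet at Φ
  change IsRestrictionMap (φ.pullbackHull D') Φ at hΦ
  change HasRestrictionDeriv (φ.pullbackHull D') Φ d at hd
  haveI : Fact Process.isProjectiveLimit_preWienerMeasure :=
    ⟨isProjectiveLimit_preWienerMeasure_holds⟩
  -- the scaling limit: an SLE_{8/3} curve `Γ` in `(D; a, b)` and its law `μ`
  obtain ⟨Γ, hΓ, -, hT⟩ := hS D a b hab
  set μ : Measure (CurveClass ℂ) := Process.preWienerMeasure.map Γ with hμdef
  have hμ : IsSLELaw ((8 : ℝ≥0) / 3) D μ := ⟨Γ, hΓ, rfl⟩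
  haveI : IsProbabilityMeasure μ := hμ.isProbabilityMeasure
  -- the pushed-forward SAW laws converge weakly to `μ`
  set ν : ℝ → Measure (CurveClass ℂ) := fun δ ↦
    (SAW.law D.carrier δ (a δ) (b δ)).map (fun γ ↦ γ.curve) with hν
  have hprob : ∀ᶠ δ in 𝓝[>] (0 : ℝ), IsProbabilityMeasure (ν δ) := by
    filter_upwards [SAWLoopFugacityFlowAssembly.eventually_isProbabilityMeasure_law hab] with δ hδ
    exact Measure.isProbabilityMeasure_map (SAW.aemeasurable_curve _ _ _ _)
  have hlim : ∀ f : CurveClass ℂ →ᵇ ℝ,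
      Tendsto (fun δ ↦ ∫ x, f x ∂ν δ) (𝓝[>] (0 : ℝ)) (𝓝 (∫ x, f x ∂μ)) := by
    intro f
    have h : Tendsto (fun δ ↦ ∫ γ, f γ.curve ∂(SAW.law D.carrier δ (a δ) (b δ))) (𝓝[>] (0 : ℝ))
        (𝓝 (∫ ω, f (Γ ω) ∂Process.preWienerMeasure)) := hT f
    rw [hμdef, integral_map hΓ.aemeasurable f.continuous.aestronglyMeasurable]
    refine h.congr' (Eventually.of_forall fun δ ↦ ?_)
    exact (integral_map (SAW.aemeasurable_curve _ _ _ _) f.continuous.aestronglyMeasurable).symm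
  -- the closed and the open event, equal under `μ` up to a null set, and the value `μ E`
  set E : Set (CurveClass ℂ) := CurveClass.rangeSubset (closure D'.carrier) with hE
  set O : Set (CurveClass ℂ) :=
    CurveClass.rangeSubset (closure (D.carrier \ D'.carrier))ᶜ with hO
  have hEc : IsClosed E := CurveClass.isClosed_rangeSubset isClosed_closure
  have hOo : IsOpen O := CurveClass.isOpen_rangeSubset isClosed_closure.isOpen_compl
  have hnull : μ (E \ O) = 0 := MutualAvoidanceLaw.sle_measure_diff_avoid_eq_zero hHull hμ
  have hval : μ E = ENNReal.ofReal (d ^ (5 / 8 : ℝ)) :=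
    SLEAvoidanceValue_proof D D' μ hμ hHull.carrier_subset hHull.pt_zero_eq hHull.pt_one_eq
      (SimpleSubseqLimits.MarkedPointRevisit.ArcRangeBoundary.exists_ball_inter_eq hHull)
      φ hφ _ rfl Φ d hΦ hd
  -- `d = Φ'_A(0) > 0`
  have hstar : IsStarHull (φ.pullbackHull D') :=
    IsStarHull.pullbackHull JordanDomain.isSimplyConnected_holds hφ hHull
  obtain ⟨d', hd'0, -, hd'⟩ := IsStarHull.exists_hasRestrictionDeriv_holds hstar hΦ
  have hd0 : 0 < d := by rw [hd.unique hstar hd']; exact hd'0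
  -- the lattice sandwich `{curve ∈ O} ⊆ E_δ(D') ⊆ {curve ∈ E}`, eventually
  have hne := IsingBoundaryRatio.Negative.eventually_ne hab
  have hOp : ∀ᶠ δ in 𝓝[>] (0 : ℝ), ν δ O ≤ SAW.law D.carrier δ (a δ) (b δ)
      {γ | ∀ e ∈ γ.walk.darts, (meshGraph D'.carrier δ).Adj e.fst e.snd ∧
        e.fst ∈ meshVertices D'.carrier δ ∧ e.snd ∈ meshVertices D'.carrier δ} :=
    Eventually.of_forall fun δ ↦ map_law_le_law hOo.measurableSet fun γ hγ ↦
      darts_of_curve_mem_rangeSubset_compl_closure_diff hHull.carrier_subset γ hγ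
  have hpE : ∀ᶠ δ in 𝓝[>] (0 : ℝ), SAW.law D.carrier δ (a δ) (b δ)
      {γ | ∀ e ∈ γ.walk.darts, (meshGraph D'.carrier δ).Adj e.fst e.snd ∧
        e.fst ∈ meshVertices D'.carrier δ ∧ e.snd ∈ meshVertices D'.carrier δ} ≤ ν δ E := by
    filter_upwards [hne] with δ hδ
    exact law_le_map_law hEc.measurableSet fun γ hγ ↦
      curve_mem_rangeSubset_of_darts D'.carrier hδ γ hγ
  have hlimit := tendsto_of_sandwich hprob hlim hEc hOo hnull _ hOp hpE
  rw [hval] at hlimit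
  have hreal := (ENNReal.tendsto_toReal ENNReal.ofReal_ne_top).comp hlimit
  rw [ENNReal.toReal_ofReal (Real.rpow_nonneg hd0.le _)] at hreal
  exact hreal

/-- **`SAWScalingLimit → AvoidanceLimit`**: the closed-range avoidance crux of route
`SAWLoopFugacityFlow` (stmt-CriticalPhenomena-10649: `P_δ(range γ_δ ⊆ cl D') → Φ'_A(0)^{5/8}`) is a
corollary of the sub-problem, via `SAWAvoidanceLaw` and the passage
`avoidanceLimit_of_sawAvoidanceLaw`. [cite: LawlerSchrammWerner2003Restriction, Thm. 6.1 (p. 23)] -/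
theorem avoidanceLimit_of_sawScalingLimit (hS : _root_.SAWScalingLimit) : AvoidanceLimit :=
  avoidanceLimit_of_sawAvoidanceLaw (sawAvoidanceLaw_of_sawScalingLimit hS)

end Summit.CriticalPhenomena.SAWScalingLimit.Theorems.SAWChargeContinuation

end

/-! ### Appendix: the lattice-topology content of the sub-problem as typed -/

noncomputable section

open MeasureTheory Filter Topology Set
open scoped NNReal ENNReal
open Literature.Probability Literature.Probability.LatticeModels
open Literature.Probability.RandomPlanarGeometry
open UpperHalfPlane (upperHalfPlaneSet)

namespace Summit.CriticalPhenomena.SAWScalingLimit.Theorems.SAWChargeContinuation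

/-- **Under `SAWScalingLimit`, the lattice avoidance event is eventually non-empty**: for every hull
subdomain `D'` of `(D; a, b)` and every endpoint approximation of `D`, for all small `δ` some
self-avoiding walk of `D_δ` from `a_δ` to `b_δ` uses only mesh vertices of `D'` and closed mesh edges
of `cl D'`. This is a statement of pure lattice topology (no SAW estimate): the weak ENDPOINT TRANSFER
"every endpoint approximation of `D` is eventually `D'`-connected inside `D_δ`" is NECESSARY for the
sub-problem as typed (cf. the kill criteria of `Theorems/AvoidanceLimit/Negative/AvoidanceLimitKillCriteria`,
where it is proved for domains with axis caps and left open for general Jordan `D`). Proof: the limit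
`d^{5/8}` in `sawAvoidanceLaw_of_sawScalingLimit` is positive (`d = Φ'_A(0) > 0`, [LSW] (2.4)) for the
restriction data of any chordal uniformizer, so the probability of the event is eventually positive.
[cite: LawlerSchrammWerner2003Restriction, (2.4) (p. 7)] -/
theorem eventually_nonempty_avoidanceEvent_of_sawScalingLimit (hS : _root_.SAWScalingLimit)
    {D D' : DobrushinDomain} (hD' : D.IsHullSubdomain D') {a b : ℝ → Site 2}
    (hab : SAW.IsEndpointApprox D a b) :
    ∀ᶠ δ in 𝓝[>] (0 : ℝ), {γ : SAW.DomainSAW D.carrier δ (a δ) (b δ) |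
      ∀ e ∈ γ.walk.darts, (meshGraph D'.carrier δ).Adj e.fst e.snd ∧
        e.fst ∈ meshVertices D'.carrier δ ∧ e.snd ∈ meshVertices D'.carrier δ}.Nonempty := by
  obtain ⟨φ, hφ⟩ := MarkedDomain.exists_isChordalUniformizing_holds D
  have hstar : IsStarHull (φ.pullbackHull D') :=
    IsStarHull.pullbackHull JordanDomain.isSimplyConnected_holds hφ hD'
  obtain ⟨Φ, hΦ, -⟩ := IsStarHull.existsUnique_isRestrictionMap_holds hstar
  obtain ⟨d, hd0, -, hd⟩ := IsStarHull.exists_hasRestrictionDeriv_holds hstar hΦ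
  have hlim := sawAvoidanceLaw_of_sawScalingLimit hS D D' hD' a b hab φ hφ Φ d hΦ hd
  have hpos : (0 : ℝ) < d ^ (5 / 8 : ℝ) := Real.rpow_pos_of_pos hd0 _
  filter_upwards [hlim.eventually (Ioi_mem_nhds hpos)] with δ hδ
  by_contra hempty
  rw [Set.not_nonempty_iff_eq_empty] at hempty
  have h0 : (SAW.law D.carrier δ (a δ) (b δ) {γ : SAW.DomainSAW D.carrier δ (a δ) (b δ) |
      ∀ e ∈ γ.walk.darts, (meshGraph D'.carrier δ).Adj e.fst e.snd ∧
        e.fst ∈ meshVertices D'.carrier δ ∧ e.snd ∈ meshVertices D'.carrier δ}).toReal = 0 := by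
    rw [hempty, measure_empty, ENNReal.toReal_zero]
  exact absurd h0 hδ.ne'

end Summit.CriticalPhenomena.SAWScalingLimit.Theorems.SAWChargeContinuation

end
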